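import Summits.CriticalPhenomena.PercolationContinuityZ3.Theorems.PercNearOneGluingNoHeavyLowerTailForestRayleighTwoSumCases
import Summits.CriticalPhenomena.PercolationContinuityZ3.Theorems.PercNearOneGluingNoHeavyLowerTailForestRayleighDispatch
import HarnessLib

/-!
# Weighted forest negative correlation — 2-sums V: the 2-sum theorem

**Theorem (`forestsW_rayleigh_twoSum`).** Let `E₁, E₂ ⊆ Sym2 V` be loop-free edge systems whose
edges live on vertex sets `S₁`, `S₂` with `S₁ ∩ S₂ ⊆ {s,t}`, `s ≠ t`, and let the marker
`m = st` lie in neither. If the weighted forest Rayleigh inequality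

  `(R)(D;K;e,f) : Z(D;K∪{e,f})·Z(D;K) ≤ Z(D;K∪{e})·Z(D;K∪{f})`,
  `Z(D;K) = Σ_{G ⊆ D, ⟨G ∪ K⟩ acyclic} ∏_{g∈G} w g`,

holds for every instance inside `E₁ ∪ {m}` and every instance inside `E₂ ∪ {m}` (all
activities `w ≥ 0`, all disjoint free/pinned sets `D, K`, all `e ≠ f` outside `D ∪ K`), then it
holds for every instance inside `E₁ ∪ E₂ ∪ {m}` — the 2-sum of the two systems along `m`, marker
kept (deleting or contracting it are the instances with `m` absent or pinned). In matroid language: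
the class of *independence-correlated* (`I`-Rayleigh) graphic matroids is closed under 2-sums
[Semple–Welsh, *Negative correlation in graphs and matroids*, CPC 17 (2008), §5 Question 2;
proved for all matroids by Cocks and by Wagner, *Negatively correlated random variables and Mason's
conjecture*, Ann. Comb. 12 (2008); here an elementary kernel proof for graphs via the two-state
decomposition of `…TwoSeparationSums`]. Degenerate separations (`|S₁ ∩ S₂| ≤ 1`) are included.

Proof: split `D, K` along the sides (`split_sides`) and dispatch on the positions of `e`, `f` and
the marker to `lsm_sep_same(_free/_pin)`, `lsm_sep_split(_free/_pin)`, `lsm_sep_marker`, whose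
inputs are instances of `(R)` inside `Eᵢ ∪ {m}`. Theorems only; no definitions, no `sorry`.
-/

open Finset SimpleGraph
open scoped Classical

namespace Summit.CriticalPhenomena.PercolationContinuityZ3.Theorems.ForestRayleigh

variable {V : Type*} [Fintype V] [DecidableEq V]

/-! ### §2 The 2-sum theorem -/

/-- **2-sums preserve the weighted forest Rayleigh property (Semple–Welsh 2008 §5 Q.2 for graphs;
Cocks / Wagner 2008 for matroids).** See the module docstring. -/
theorem forestsW_rayleigh_twoSum (E₁ E₂ : Finset (Sym2 V)) (S₁ S₂ : Set V) (s t : V)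
    (hE₁ : ∀ z ∈ E₁, ∀ x ∈ z, x ∈ S₁) (hE₂ : ∀ z ∈ E₂, ∀ x ∈ z, x ∈ S₂)
    (hS : ∀ x, x ∈ S₁ → x ∈ S₂ → x = s ∨ x = t) (hst : s ≠ t)
    (hL₁ : ∀ z ∈ E₁, ¬z.IsDiag) (hL₂ : ∀ z ∈ E₂, ¬z.IsDiag)
    (hm₁ : s(s, t) ∉ E₁) (hm₂ : s(s, t) ∉ E₂)
    (hR₁ : ∀ (w : Sym2 V → ℝ), (∀ x, 0 ≤ w x) → ∀ (D K : Finset (Sym2 V)) (e f : Sym2 V),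
      D ∪ insert e (insert f K) ⊆ insert s(s, t) E₁ → Disjoint D K → e ∉ D → e ∉ K → f ∉ D →
      f ∉ K → e ≠ f →
      (∑ G ∈ D.powerset.filter (fun G =>
        (fromEdgeSet ((G ∪ (insert e (insert f K)) : Finset (Sym2 V)) : Set (Sym2 V))).IsAcyclic), ∏ x ∈ G, w x) *
        (∑ G ∈ D.powerset.filter (fun G =>
        (fromEdgeSet ((G ∪ (K) : Finset (Sym2 V)) : Set (Sym2 V))).IsAcyclic), ∏ x ∈ G, w x) ≤
      (∑ G ∈ D.powerset.filter (fun G =>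
        (fromEdgeSet ((G ∪ (insert e K) : Finset (Sym2 V)) : Set (Sym2 V))).IsAcyclic), ∏ x ∈ G, w x) *
        (∑ G ∈ D.powerset.filter (fun G =>
        (fromEdgeSet ((G ∪ (insert f K) : Finset (Sym2 V)) : Set (Sym2 V))).IsAcyclic), ∏ x ∈ G, w x))
    (hR₂ : ∀ (w : Sym2 V → ℝ), (∀ x, 0 ≤ w x) → ∀ (D K : Finset (Sym2 V)) (e f : Sym2 V),
      D ∪ insert e (insert f K) ⊆ insert s(s, t) E₂ → Disjoint D K → e ∉ D → e ∉ K → f ∉ D →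
      f ∉ K → e ≠ f →
      (∑ G ∈ D.powerset.filter (fun G =>
        (fromEdgeSet ((G ∪ (insert e (insert f K)) : Finset (Sym2 V)) : Set (Sym2 V))).IsAcyclic), ∏ x ∈ G, w x) *
        (∑ G ∈ D.powerset.filter (fun G =>
        (fromEdgeSet ((G ∪ (K) : Finset (Sym2 V)) : Set (Sym2 V))).IsAcyclic), ∏ x ∈ G, w x) ≤
      (∑ G ∈ D.powerset.filter (fun G =>
        (fromEdgeSet ((G ∪ (insert e K) : Finset (Sym2 V)) : Set (Sym2 V))).IsAcyclic), ∏ x ∈ G, w x) *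
        (∑ G ∈ D.powerset.filter (fun G =>
        (fromEdgeSet ((G ∪ (insert f K) : Finset (Sym2 V)) : Set (Sym2 V))).IsAcyclic), ∏ x ∈ G, w x)) :
    ∀ (w : Sym2 V → ℝ), (∀ x, 0 ≤ w x) → ∀ (D K : Finset (Sym2 V)) (e f : Sym2 V),
      D ∪ insert e (insert f K) ⊆ insert s(s, t) (E₁ ∪ E₂) → Disjoint D K → e ∉ D → e ∉ K → f ∉ D →
      f ∉ K → e ≠ f →
      (∑ G ∈ D.powerset.filter (fun G =>
        (fromEdgeSet ((G ∪ (insert e (insert f K)) : Finset (Sym2 V)) : Set (Sym2 V))).IsAcyclic), ∏ x ∈ G, w x) *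
        (∑ G ∈ D.powerset.filter (fun G =>
        (fromEdgeSet ((G ∪ (K) : Finset (Sym2 V)) : Set (Sym2 V))).IsAcyclic), ∏ x ∈ G, w x) ≤
      (∑ G ∈ D.powerset.filter (fun G =>
        (fromEdgeSet ((G ∪ (insert e K) : Finset (Sym2 V)) : Set (Sym2 V))).IsAcyclic), ∏ x ∈ G, w x) *
        (∑ G ∈ D.powerset.filter (fun G =>
        (fromEdgeSet ((G ∪ (insert f K) : Finset (Sym2 V)) : Set (Sym2 V))).IsAcyclic), ∏ x ∈ G, w x) := by
  intro w hw D K e f hsub hDK heD heK hfD hfK hef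
  have hS' : ∀ x, x ∈ S₂ → x ∈ S₁ → x = s ∨ x = t := fun x h₂ h₁ => hS x h₁ h₂
  have hsub₁ : D ∪ insert e (insert f K) ⊆ insert s(s, t) (E₂ ∪ E₁) := by
    rwa [Finset.union_comm E₂]
  have hsub₂ : D ∪ insert f (insert e K) ⊆ insert s(s, t) (E₁ ∪ E₂) := by
    rwa [Finset.insert_comm]
  have hsub₃ : D ∪ insert f (insert e K) ⊆ insert s(s, t) (E₂ ∪ E₁) := by
    rwa [Finset.union_comm E₂]
  have he : e ∈ insert s(s, t) (E₁ ∪ E₂) :=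
    hsub (Finset.mem_union_right _ (Finset.mem_insert_self _ _))
  have hf : f ∈ insert s(s, t) (E₁ ∪ E₂) :=
    hsub (Finset.mem_union_right _ (Finset.mem_insert_of_mem (Finset.mem_insert_self _ _)))
  simp only [Finset.mem_insert, Finset.mem_union] at he hf
  rcases he with he | he | he
  · -- `e` is the marker
    rcases hf with hf | hf | hf
    · exact absurd (he.trans hf.symm) hef
    · exact twoSum_case_marker hE₂ hE₁ hS' hst hL₂ hL₁ hm₂ hm₁ hR₁ w hw D K e f hsub₁ hDK heD heK
        hfD hfK hef he hf
    · exact twoSum_case_marker hE₁ hE₂ hS hst hL₁ hL₂ hm₁ hm₂ hR₂ w hw D K e f hsub hDK heD heK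
        hfD hfK hef he hf
  · rcases hf with hf | hf | hf
    · exact lsm_symm w D K e f (twoSum_case_marker hE₂ hE₁ hS' hst hL₂ hL₁ hm₂ hm₁ hR₁ w hw D K
        f e hsub₃ hDK hfD hfK heD heK hef.symm hf he)
    · exact twoSum_case_same hE₁ hE₂ hS hst hL₁ hL₂ hm₁ hm₂ hR₁ w hw D K e f hsub hDK heD heK hfD
        hfK hef he hf
    · exact twoSum_case_split hE₁ hE₂ hS hst hL₁ hL₂ hm₁ hm₂ hR₁ hR₂ w hw D K e f hsub hDK heD
        heK hfD hfK he hf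
  · rcases hf with hf | hf | hf
    · exact lsm_symm w D K e f (twoSum_case_marker hE₁ hE₂ hS hst hL₁ hL₂ hm₁ hm₂ hR₂ w hw D K
        f e hsub₂ hDK hfD hfK heD heK hef.symm hf he)
    · exact twoSum_case_split hE₂ hE₁ hS' hst hL₂ hL₁ hm₂ hm₁ hR₂ hR₁ w hw D K e f hsub₁ hDK heD
        heK hfD hfK he hf
    · exact twoSum_case_same hE₂ hE₁ hS' hst hL₂ hL₁ hm₂ hm₁ hR₂ w hw D K e f hsub₁ hDK heD heK
        hfD hfK hef he hf

end Summit.CriticalPhenomena.PercolationContinuityZ3.Theorems.ForestRayleigh
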